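import Mathlib.Analysis.Calculus.FDeriv.Const
import Mathlib.Analysis.Calculus.ContDiff.Basic
import Mathlib.Analysis.Normed.Group.Bounded
import Literature.Geometry.MetricEmbeddings.HeisenbergDisplacementCount
import HarnessLib

/-!
# The lattice bump partition of unity on `ℍ(ℝ)`: smoothness, supports, the identity
`Σ_g χ_g ≡ 1`, left-invariance of the horizontal derivatives, and the window around a point

Family `pnp`, layer `Literature/Geometry/MetricEmbeddings`; proofs about the vocabulary of
`HeisenbergLatticeBump.lean` (theorems only). Source: A. Naor, R. Young, *Vertical perimeter versus
horizontal perimeter*, Ann. of Math. 188 (2018) = arXiv:1701.00620, §3.2 Lemma 3.6 (arXiv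
pp. 22–23): "we can fix from now on a compactly supported smooth function `χ : ℍ^{2k+1} → [0,1]`
such that `Σ_{g ∈ ℍ_ℤ^{2k+1}} χ(g⁻¹h) = 1` for all `h` […] `Φ(h) ≝ Σ_g χ(g⁻¹h) f(g)` […] the
support of `Φ` is contained in `ST`. Hence `Φ` is compactly supported […] Arguing identically to
the proof of equation (56) of [LN14] […] `sup_{h ∈ gT} ‖∇_ℍ Φ(h)‖ ≲ Σ_{z ∈ 𝓑_{2m}} ‖f(gz) − f(g)‖`",
and V. Lafforgue, A. Naor, Israel J. Math. 203 (2014) = arXiv:1212.2107, §3.3 (proof of Thm. 3.1: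
"Note that it follows from (55) that `Σ_{x∈ℍ} ∇_ℍ χ_x(h) = 0`. Observe that if `x ∈ ℍ` satisfies
`∇_ℍχ_x(h) ≠ 0` then necessarily `x⁻¹h ∈ A` […]").

PROVED here, for the EXPLICIT bump `χ = bump3`, its lattice translates `χ_g = bumpAt g` and the
smearing `F = smear Ω` of `HeisenbergLatticeBump.lean` (matrix model of `ℍ(ℝ)` on `ℝ × ℝ × ℝ`,
left translation `u ↦ g⁻¹u = mulR (invR (castR g)) u`):

* `bump1`/`bumpAt`: values in `[0,1]`, supports (`bump1_ne_zero`, `bumpAt_ne_zero`,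
  `bumpAt_eq_zero_of_not_mem_box`), smoothness (`contDiff_bump1`, `contDiff_bumpAt`,
  `contDiff_smear`), compact support (`hasCompactSupport_bumpAt`, `hasCompactSupport_smear`);
* the EXACT PARTITION OF UNITY in window form: `sum_bump1_window` (`Σ_n ρ(s − n) = 1`
  telescopes), `sum_bumpAt_window` (`Σ_{(a,b,c)} χ_{(a,b,c)}(u) = 1`, the `c`-sum first);
* calculus: `hasFDerivAt_mulR_invR_castR` (left translations are affine, linear part the shear
  `(v₁,v₂,v₃) ↦ (v₁,v₂,v₃ − a v₂)`), LEFT-INVARIANCE of the horizontal derivatives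
  `fderiv_bumpAt_dirX` / `fderiv_bumpAt_dirY` (`X = D(·)[(1,0,0)]`, `Y_u = D(·)[(0,1,u₁)]`),
  `exists_bound_fderiv_bump3` (`|Xχ| + |Yχ| ≤ M`), `fderiv_bumpAt_eq_zero` (off `g⁻¹u ∈ [0,2]³`);
* the WINDOW around a point `u₀` (`a, b ∈ [⌊u₀ᵢ⌋−2, ⌊u₀ᵢ⌋+1]`, `c` in a range of width
  `2⌈4(|u₀₁|+3)⌉+6`): the translates in the window sum to `1` on the sup-norm unit neighbourhood
  of `u₀` (`sum_bumpAt_window_near`), hence their derivatives at `u₀` sum to `0`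
  (`sum_fderiv_bumpAt_window_eq_zero`), and every translate not vanishing near `u₀` is in the
  window (`exists_window_index_of_bumpAt_ne_zero`); relevant translates (`g⁻¹u₀ ∈ [0,2]³`) have
  `y⁻¹g ∈ 𝓑_{30}` for the cell point `y` of `u₀` (`heisInv_mul_mem_wordBall_of_rel`).

## References

* [NaorYoung2018] A. Naor, R. Young, Ann. of Math. 188 (2018) 171–279, §2, §3.2 Lemma 3.6
  (arXiv:1701.00620 pp. 12–14, 22–23; arXiv numbering).
-/

noncomputable section

open Finset
open scoped ContDiff

namespace Literature.Geometry.MetricEmbeddings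

/-! ### The bump partition of unity -/

/-- `ρ ≥ 0`. [folklore] -/
theorem bump1_nonneg (s : ℝ) : 0 ≤ bump1 s := by
  unfold bump1
  have := Real.smoothTransition.monotone (show s - 1 ≤ s by linarith)
  linarith

/-- `ρ ≤ 1`. [folklore] -/
theorem bump1_le_one (s : ℝ) : bump1 s ≤ 1 := by
  unfold bump1
  linarith [Real.smoothTransition.le_one s, Real.smoothTransition.nonneg (s - 1)]

/-- `ρ = 0` on `(−∞, 0]`. [folklore] -/
theorem bump1_of_nonpos {s : ℝ} (hs : s ≤ 0) : bump1 s = 0 := by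
  unfold bump1
  rw [Real.smoothTransition.zero_of_nonpos hs, Real.smoothTransition.zero_of_nonpos (by linarith)]
  ring

/-- `ρ = 0` on `[2, ∞)`. [folklore] -/
theorem bump1_of_two_le {s : ℝ} (hs : 2 ≤ s) : bump1 s = 0 := by
  unfold bump1
  rw [Real.smoothTransition.one_of_one_le (by linarith),
    Real.smoothTransition.one_of_one_le (by linarith)]
  ring

/-- The support of `ρ` lies in `(0, 2)`. [folklore] -/
theorem bump1_ne_zero {s : ℝ} (h : bump1 s ≠ 0) : 0 < s ∧ s < 2 := by
  by_contra hcon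
  rw [not_and_or, not_lt, not_lt] at hcon
  rcases hcon with h1 | h1
  · exact h (bump1_of_nonpos h1)
  · exact h (bump1_of_two_le h1)

/-- `ρ` is smooth. [folklore] -/
theorem contDiff_bump1 : ContDiff ℝ ∞ bump1 := by
  have h1 : ContDiff ℝ ∞ fun s : ℝ => Real.smoothTransition (s - 1) :=
    Real.smoothTransition.contDiff.comp (contDiff_id.sub contDiff_const)
  exact Real.smoothTransition.contDiff.sub h1

/-- `ρ` is continuous. [folklore] -/
theorem continuous_bump1 : Continuous bump1 := contDiff_bump1.continuous

/-- **Exact partition of unity by integer translates of `ρ`** (window form): if the integer window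
`{p, p+1, …, p+m-1}` contains `⌊s⌋ - 1` and `⌊s⌋` (i.e. `p ≤ s - 1` and `s ≤ p + m`), then
`Σ_{i<m} ρ(s − (p+i)) = 1` — the sum telescopes to `θ(s − p) − θ(s − p − m) = 1 − 0`. [folklore] -/
theorem sum_bump1_window (s : ℝ) (p : ℤ) (m : ℕ) (h1 : (p : ℝ) ≤ s - 1) (h2 : s ≤ p + m) :
    ∑ i ∈ Finset.range m, bump1 (s - ((p : ℝ) + i)) = 1 := by
  have key : ∀ i : ℕ, bump1 (s - ((p : ℝ) + i)) =
      Real.smoothTransition (s - p - (i : ℕ)) - Real.smoothTransition (s - p - ((i + 1 : ℕ) : ℝ)) := by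
    intro i
    unfold bump1
    congr 1
    · congr 1
      ring
    · congr 1
      push_cast
      ring
  simp_rw [key]
  rw [Finset.sum_range_sub' (fun i : ℕ => Real.smoothTransition (s - p - (i : ℝ))) m]
  simp only [Nat.cast_zero, sub_zero]
  rw [Real.smoothTransition.one_of_one_le (by linarith),
    Real.smoothTransition.zero_of_nonpos (by linarith)]
  norm_num

/-- The translated bump in coordinates: for `g = (a,b,c)`,
`χ_g(u) = ρ(u₁ − a) ρ(u₂ − b) ρ(u₃ − c − a(u₂ − b))` (`g⁻¹u = (u₁−a, u₂−b, u₃−c−a(u₂−b))`).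
[cite: NaorYoung2018, §3.2 Lemma 3.6] -/
theorem bumpAt_apply (g : ℤ × ℤ × ℤ) (u : ℝ × ℝ × ℝ) :
    bumpAt g u = bump1 (u.1 - g.1) * bump1 (u.2.1 - g.2.1) *
      bump1 (u.2.2 - g.2.2 - g.1 * (u.2.1 - g.2.1)) := by
  have e1 : -(g.1 : ℝ) + u.1 = u.1 - g.1 := by ring
  have e2 : -(g.2.1 : ℝ) + u.2.1 = u.2.1 - g.2.1 := by ring
  have e3 : -(g.2.2 : ℝ) + (g.1 : ℝ) * g.2.1 + u.2.2 + -(g.1 : ℝ) * u.2.1 =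
      u.2.2 - g.2.2 - g.1 * (u.2.1 - g.2.1) := by ring
  simp only [bumpAt, bump3, mulR, invR, castR, e1, e2, e3]

/-- `0 ≤ χ_g`. [cite: NaorYoung2018, §3.2 Lemma 3.6] -/
theorem bumpAt_nonneg (g : ℤ × ℤ × ℤ) (u : ℝ × ℝ × ℝ) : 0 ≤ bumpAt g u := by
  rw [bumpAt_apply]
  exact mul_nonneg (mul_nonneg (bump1_nonneg _) (bump1_nonneg _)) (bump1_nonneg _)

/-- `χ_g ≤ 1`. [cite: NaorYoung2018, §3.2 Lemma 3.6] -/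
theorem bumpAt_le_one (g : ℤ × ℤ × ℤ) (u : ℝ × ℝ × ℝ) : bumpAt g u ≤ 1 := by
  rw [bumpAt_apply]
  exact mul_le_one₀ (mul_le_one₀ (bump1_le_one _) (bump1_nonneg _) (bump1_le_one _))
    (bump1_nonneg _) (bump1_le_one _)

/-- **Support of `χ_g`**: if `χ_g(u) ≠ 0` then the three coordinates of `g⁻¹u` lie in `(0, 2)`.
[cite: NaorYoung2018, §3.2 Lemma 3.6] -/
theorem bumpAt_ne_zero {g : ℤ × ℤ × ℤ} {u : ℝ × ℝ × ℝ} (h : bumpAt g u ≠ 0) :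
    (0 < u.1 - g.1 ∧ u.1 - g.1 < 2) ∧ (0 < u.2.1 - g.2.1 ∧ u.2.1 - g.2.1 < 2) ∧
      (0 < u.2.2 - g.2.2 - g.1 * (u.2.1 - g.2.1) ∧ u.2.2 - g.2.2 - g.1 * (u.2.1 - g.2.1) < 2) := by
  rw [bumpAt_apply] at h
  refine ⟨bump1_ne_zero ?_, bump1_ne_zero ?_, bump1_ne_zero ?_⟩
  · intro h0; apply h; rw [h0]; ring
  · intro h0; apply h; rw [h0]; ring
  · intro h0; apply h; rw [h0]; ring

/-- **Exact partition of unity by the lattice translates `χ_g`** (window form): for `u ∈ ℍ(ℝ)`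
and integer windows `a ∈ {p₁,…,p₁+m-1}`, `b ∈ {p₂,…,p₂+m-1}` containing `⌊u₁⌋-1, ⌊u₁⌋`, resp.
`⌊u₂⌋-1, ⌊u₂⌋`, and a `c`-window `{p₃,…,p₃+m₃-1}` containing `⌊u₃ − a(u₂−b)⌋ - 1, ⌊u₃ − a(u₂−b)⌋`
for all those `a, b`: `Σ_{(a,b,c) in the window} χ_{(a,b,c)}(u) = 1` (the `c`-sum, then the `b`-sum,
then the `a`-sum telescope). This is the identity "`Σ_{x ∈ ℍ} χ_x(h) = 1`" for the explicit bump.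
[cite: NaorYoung2018, §3.2 Lemma 3.6] -/
theorem sum_bumpAt_window (u : ℝ × ℝ × ℝ) (p₁ p₂ p₃ : ℤ) (m m₃ : ℕ)
    (h1 : (p₁ : ℝ) ≤ u.1 - 1) (h1' : u.1 ≤ p₁ + m) (h2 : (p₂ : ℝ) ≤ u.2.1 - 1) (h2' : u.2.1 ≤ p₂ + m)
    (h3 : ∀ i ∈ Finset.range m, ∀ j ∈ Finset.range m,
      (p₃ : ℝ) ≤ u.2.2 - ((p₁ : ℝ) + i) * (u.2.1 - ((p₂ : ℝ) + j)) - 1 ∧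
        u.2.2 - ((p₁ : ℝ) + i) * (u.2.1 - ((p₂ : ℝ) + j)) ≤ p₃ + m₃) :
    ∑ i ∈ Finset.range m, ∑ j ∈ Finset.range m, ∑ k ∈ Finset.range m₃,
      bumpAt (p₁ + i, p₂ + j, p₃ + k) u = 1 := by
  have step : ∀ i ∈ Finset.range m, ∀ j ∈ Finset.range m,
      ∑ k ∈ Finset.range m₃, bumpAt (p₁ + i, p₂ + j, p₃ + k) u =
        bump1 (u.1 - ((p₁ : ℝ) + i)) * bump1 (u.2.1 - ((p₂ : ℝ) + j)) := by
    intro i hi j hj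
    have hk : ∀ k : ℕ, bumpAt (p₁ + i, p₂ + j, p₃ + k) u =
        bump1 (u.1 - ((p₁ : ℝ) + i)) * bump1 (u.2.1 - ((p₂ : ℝ) + j)) *
          bump1 ((u.2.2 - ((p₁ : ℝ) + i) * (u.2.1 - ((p₂ : ℝ) + j))) - ((p₃ : ℝ) + k)) := by
      intro k
      rw [bumpAt_apply]
      push_cast
      ring_nf
    simp_rw [hk]
    rw [← Finset.mul_sum, sum_bump1_window _ p₃ m₃ (h3 i hi j hj).1 (h3 i hi j hj).2, mul_one]
  calc ∑ i ∈ Finset.range m, ∑ j ∈ Finset.range m, ∑ k ∈ Finset.range m₃,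
        bumpAt (p₁ + i, p₂ + j, p₃ + k) u
      = ∑ i ∈ Finset.range m, ∑ j ∈ Finset.range m,
          bump1 (u.1 - ((p₁ : ℝ) + i)) * bump1 (u.2.1 - ((p₂ : ℝ) + j)) :=
        Finset.sum_congr rfl fun i hi => Finset.sum_congr rfl fun j hj => step i hi j hj
    _ = ∑ i ∈ Finset.range m, bump1 (u.1 - ((p₁ : ℝ) + i)) := by
        refine Finset.sum_congr rfl fun i _ => ?_
        rw [← Finset.mul_sum, sum_bump1_window _ p₂ m h2 h2', mul_one]
    _ = 1 := sum_bump1_window _ p₁ m h1 h1'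

/-- The bump `χ` is smooth. [cite: NaorYoung2018, §3.2 Lemma 3.6] -/
theorem contDiff_bump3 : ContDiff ℝ ∞ bump3 := by
  unfold bump3
  exact ((contDiff_bump1.comp contDiff_fst).mul
    (contDiff_bump1.comp (contDiff_fst.comp contDiff_snd))).mul
      (contDiff_bump1.comp (contDiff_snd.comp contDiff_snd))

/-- Left translations of `ℍ(ℝ)` are smooth (polynomial) maps. [cite: NaorYoung2018, §2] -/
theorem contDiff_mulR (g : ℝ × ℝ × ℝ) : ContDiff ℝ ∞ (mulR g) := by
  unfold mulR
  fun_prop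

/-- The translated bumps `χ_g` are smooth. [cite: NaorYoung2018, §3.2 Lemma 3.6] -/
theorem contDiff_bumpAt (g : ℤ × ℤ × ℤ) : ContDiff ℝ ∞ (bumpAt g) :=
  contDiff_bump3.comp (contDiff_mulR _)

/-- The smearing `F = Σ_{g ∈ Ω} χ_g` is smooth. [cite: NaorYoung2018, §3.2 Lemma 3.6] -/
theorem contDiff_smear (Ω : Finset (ℤ × ℤ × ℤ)) : ContDiff ℝ ∞ (smear Ω) := by
  unfold smear
  exact ContDiff.sum fun g _ => contDiff_bumpAt g

/-- **A compact box containing the support of `χ_g`**: `χ_g(u) ≠ 0` forces `u₁ ∈ (a, a+2)`,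
`u₂ ∈ (b, b+2)`, `u₃ ∈ (c + a(u₂−b), c + a(u₂−b) + 2)`, hence
`u ∈ [a, a+2] × [b, b+2] × [c − 2|a|, c + 2|a| + 2]`. [cite: NaorYoung2018, §3.2 Lemma 3.6] -/
theorem bumpAt_eq_zero_of_not_mem_box {g : ℤ × ℤ × ℤ} {u : ℝ × ℝ × ℝ}
    (hu : u ∉ Set.Icc (g.1 : ℝ) (g.1 + 2) ×ˢ (Set.Icc (g.2.1 : ℝ) (g.2.1 + 2) ×ˢ
      Set.Icc ((g.2.2 : ℝ) - 2 * |(g.1 : ℝ)|) (g.2.2 + 2 * |(g.1 : ℝ)| + 2))) : bumpAt g u = 0 := by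
  by_contra h
  obtain ⟨⟨h1, h1'⟩, ⟨h2, h2'⟩, ⟨h3, h3'⟩⟩ := bumpAt_ne_zero h
  apply hu
  simp only [Set.mem_prod, Set.mem_Icc]
  have hab : |(g.1 : ℝ) * (u.2.1 - g.2.1)| ≤ 2 * |(g.1 : ℝ)| := by
    rw [abs_mul]
    have : |u.2.1 - (g.2.1 : ℝ)| ≤ 2 := abs_le.mpr ⟨by linarith, by linarith⟩
    nlinarith [abs_nonneg (g.1 : ℝ)]
  have hab' := abs_le.mp hab
  exact ⟨⟨by linarith, by linarith⟩, ⟨by linarith, by linarith⟩, ⟨by linarith, by linarith⟩⟩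

/-- `χ_g` has compact support. [cite: NaorYoung2018, §3.2 Lemma 3.6] -/
theorem hasCompactSupport_bumpAt (g : ℤ × ℤ × ℤ) : HasCompactSupport (bumpAt g) :=
  HasCompactSupport.intro (K := Set.Icc (g.1 : ℝ) (g.1 + 2) ×ˢ (Set.Icc (g.2.1 : ℝ) (g.2.1 + 2) ×ˢ
      Set.Icc ((g.2.2 : ℝ) - 2 * |(g.1 : ℝ)|) (g.2.2 + 2 * |(g.1 : ℝ)| + 2)))
    (isCompact_Icc.prod (isCompact_Icc.prod isCompact_Icc))
    fun _ hu => bumpAt_eq_zero_of_not_mem_box hu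

/-- The smearing `F` has compact support. [cite: NaorYoung2018, §3.2 Lemma 3.6] -/
theorem hasCompactSupport_smear (Ω : Finset (ℤ × ℤ × ℤ)) : HasCompactSupport (smear Ω) := by
  have h : smear Ω = ∑ g ∈ Ω, bumpAt g := by
    funext u
    rw [Finset.sum_apply]
    rfl
  rw [h]
  exact HasCompactSupport.finset_sum fun g _ => hasCompactSupport_bumpAt g


/-! ### Derivatives of the translated bumps -/

section Calculus

open Filter _root_.Topology

/-- The translation `u ↦ g⁻¹u` in coordinates: `(u₁ − a, u₂ − b, u₃ − c + ab − a u₂)`.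
[cite: NaorYoung2018, §2] -/
theorem mulR_invR_castR_apply (g : ℤ × ℤ × ℤ) (u : ℝ × ℝ × ℝ) :
    mulR (invR (castR g)) u = (u.1 - g.1, u.2.1 - g.2.1, u.2.2 - g.2.2 + g.1 * g.2.1 - g.1 * u.2.1) := by
  simp only [mulR, invR, castR, Prod.mk.injEq]
  exact ⟨by ring, by ring, by ring⟩

/-- **Left translations are affine with the shear `(v₁, v₂, v₃) ↦ (v₁, v₂, v₃ − a v₂)` as linear
part**: `u ↦ g⁻¹u` has this Fréchet derivative everywhere. [cite: NaorYoung2018, §2] -/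
theorem hasFDerivAt_mulR_invR_castR (g : ℤ × ℤ × ℤ) (u : ℝ × ℝ × ℝ) :
    HasFDerivAt (mulR (invR (castR g)))
      ((ContinuousLinearMap.fst ℝ ℝ (ℝ × ℝ)).prod
        (((ContinuousLinearMap.fst ℝ ℝ ℝ).comp (ContinuousLinearMap.snd ℝ ℝ (ℝ × ℝ))).prod
          (((ContinuousLinearMap.snd ℝ ℝ ℝ).comp (ContinuousLinearMap.snd ℝ ℝ (ℝ × ℝ))) -
            (g.1 : ℝ) • ((ContinuousLinearMap.fst ℝ ℝ ℝ).comp (ContinuousLinearMap.snd ℝ ℝ (ℝ × ℝ)))))) u := by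
  set A := (ContinuousLinearMap.fst ℝ ℝ (ℝ × ℝ)).prod
        (((ContinuousLinearMap.fst ℝ ℝ ℝ).comp (ContinuousLinearMap.snd ℝ ℝ (ℝ × ℝ))).prod
          (((ContinuousLinearMap.snd ℝ ℝ ℝ).comp (ContinuousLinearMap.snd ℝ ℝ (ℝ × ℝ))) -
            (g.1 : ℝ) • ((ContinuousLinearMap.fst ℝ ℝ ℝ).comp (ContinuousLinearMap.snd ℝ ℝ (ℝ × ℝ))))) with hA
  have hfun : mulR (invR (castR g)) = fun u => A u + (-(g.1 : ℝ), -(g.2.1 : ℝ), -(g.2.2 : ℝ) + g.1 * g.2.1) := by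
    funext v
    rw [mulR_invR_castR_apply]
    simp [hA]
    exact ⟨by ring, by ring, by ring⟩
  rw [hfun]
  exact A.hasFDerivAt.add_const _

/-- **Left-invariance of the horizontal derivative `X`**: `X(χ ∘ L)(u) = (Xχ)(L u)` for the
translation `L = (u ↦ g⁻¹u)` and the direction `X = (1,0,0)` (`u ↦ u·(s,0,0) = (u₁+s, u₂, u₃)`).
[cite: NaorYoung2018, §2] -/
theorem fderiv_bumpAt_dirX (g : ℤ × ℤ × ℤ) (u : ℝ × ℝ × ℝ) :
    fderiv ℝ (bumpAt g) u (1, 0, 0) = fderiv ℝ bump3 (mulR (invR (castR g)) u) (1, 0, 0) := by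
  have hT := hasFDerivAt_mulR_invR_castR g u
  have hb : HasFDerivAt bump3 (fderiv ℝ bump3 (mulR (invR (castR g)) u)) (mulR (invR (castR g)) u) :=
    ((contDiff_bump3.differentiable (by simp)) _).hasFDerivAt
  have hcomp := hb.comp u hT
  have e : bumpAt g = bump3 ∘ mulR (invR (castR g)) := rfl
  rw [e, hcomp.fderiv]
  simp

/-- **Left-invariance of the horizontal derivative `Y`**: `Y(χ ∘ L)(u) = (Yχ)(L u)` for
`L = (u ↦ g⁻¹u)` and the left-invariant direction field `Y_u = (0, 1, u₁)`
(`u ↦ u·(0,s,0) = (u₁, u₂+s, u₃+u₁s)`); note `(g⁻¹u)₁ = u₁ − a`. [cite: NaorYoung2018, §2] -/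
theorem fderiv_bumpAt_dirY (g : ℤ × ℤ × ℤ) (u : ℝ × ℝ × ℝ) :
    fderiv ℝ (bumpAt g) u (0, 1, u.1) =
      fderiv ℝ bump3 (mulR (invR (castR g)) u) (0, 1, (mulR (invR (castR g)) u).1) := by
  have hT := hasFDerivAt_mulR_invR_castR g u
  have hb : HasFDerivAt bump3 (fderiv ℝ bump3 (mulR (invR (castR g)) u)) (mulR (invR (castR g)) u) :=
    ((contDiff_bump3.differentiable (by simp)) _).hasFDerivAt
  have hcomp := hb.comp u hT
  have e : bumpAt g = bump3 ∘ mulR (invR (castR g)) := rfl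
  rw [e, hcomp.fderiv]
  have e1 : (mulR (invR (castR g)) u).1 = u.1 - g.1 := by rw [mulR_invR_castR_apply]
  simp [e1]

/-- The horizontal gradient of the bump `χ` is bounded: there is `M` with
`|Xχ(w)| + |Y χ(w)| ≤ M` for all `w` (`χ` is `C¹` with compact support; the direction field
`Y_w = (0,1,w₁)` is unbounded but `Dχ` vanishes off a compact set).
[cite: NaorYoung2018, §3.2 Lemma 3.6] -/
theorem exists_bound_fderiv_bump3 : ∃ M : ℝ, 0 ≤ M ∧ ∀ w : ℝ × ℝ × ℝ,
    |fderiv ℝ bump3 w (1, 0, 0)| + |fderiv ℝ bump3 w (0, 1, w.1)| ≤ M := by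
  have hcont : Continuous (fderiv ℝ bump3) := contDiff_bump3.continuous_fderiv (by simp)
  have hb3 : HasCompactSupport bump3 := by
    refine HasCompactSupport.intro (K := Set.Icc (0 : ℝ) 2 ×ˢ (Set.Icc (0 : ℝ) 2 ×ˢ Set.Icc (0 : ℝ) 2))
      (isCompact_Icc.prod (isCompact_Icc.prod isCompact_Icc)) fun w hw => ?_
    -- `bump3` vanishes off `(0,2)³`
    by_cases h : bump3 w = 0
    · exact h
    · exfalso
      apply hw
      simp only [Set.mem_prod, Set.mem_Icc]
      unfold bump3 at h
      have h1 : bump1 w.1 ≠ 0 := fun h0 => h (by rw [h0]; ring)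
      have h2 : bump1 w.2.1 ≠ 0 := fun h0 => h (by rw [h0]; ring)
      have h3 : bump1 w.2.2 ≠ 0 := fun h0 => h (by rw [h0]; ring)
      obtain ⟨a1, a2⟩ := bump1_ne_zero h1
      obtain ⟨b1, b2⟩ := bump1_ne_zero h2
      obtain ⟨c1, c2⟩ := bump1_ne_zero h3
      exact ⟨⟨a1.le, a2.le⟩, ⟨b1.le, b2.le⟩, ⟨c1.le, c2.le⟩⟩
  have hsupp : HasCompactSupport (fderiv ℝ bump3) := hb3.fderiv (𝕜 := ℝ)
  -- the two coordinate functions are continuous with compact support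
  set G1 : ℝ × ℝ × ℝ → ℝ := fun w => fderiv ℝ bump3 w (1, 0, 0) with hG1
  set G2 : ℝ × ℝ × ℝ → ℝ := fun w => fderiv ℝ bump3 w (0, 1, w.1) with hG2
  have hc1 : Continuous G1 := hcont.clm_apply continuous_const
  have hc2 : Continuous G2 := by
    refine hcont.clm_apply ?_
    exact continuous_const.prodMk (continuous_const.prodMk continuous_fst)
  have hs1 : HasCompactSupport G1 :=
    hsupp.mono fun w hw => by
      intro h0
      apply hw
      show fderiv ℝ bump3 w (1, 0, 0) = 0
      rw [h0]
      simp
  have hs2 : HasCompactSupport G2 :=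
    hsupp.mono fun w hw => by
      intro h0
      apply hw
      show fderiv ℝ bump3 w (0, 1, w.1) = 0
      rw [h0]
      simp
  obtain ⟨C1, hC1⟩ := hs1.exists_bound_of_continuous hc1
  obtain ⟨C2, hC2⟩ := hs2.exists_bound_of_continuous hc2
  refine ⟨|C1| + |C2|, by positivity, fun w => ?_⟩
  have h1 := hC1 w
  have h2 := hC2 w
  rw [Real.norm_eq_abs] at h1 h2
  exact add_le_add (h1.trans (le_abs_self C1)) (h2.trans (le_abs_self C2))

/-- If `χ_g` vanishes on a neighbourhood of `u`, its derivative at `u` vanishes.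
[cite: NaorYoung2018, §3.2 Lemma 3.6] -/
theorem fderiv_eq_zero_of_eventually_eq_zero {f : ℝ × ℝ × ℝ → ℝ} {u : ℝ × ℝ × ℝ}
    (h : ∀ᶠ v in 𝓝 u, f v = 0) : fderiv ℝ f u = 0 := by
  have h0 : HasFDerivAt f (0 : ℝ × ℝ × ℝ →L[ℝ] ℝ) u :=
    (hasFDerivAt_const (0 : ℝ) u).congr_of_eventuallyEq (h.mono fun v hv => by simp [hv])
  exact h0.fderiv

/-- **Off-support vanishing of the derivative of `χ_g`**: if `g⁻¹u ∉ [0,2]³` then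
`Dχ_g(u) = 0` (`χ` is supported in `(0,2)³` and the complement of the closed box is open).
[cite: NaorYoung2018, §3.2 Lemma 3.6] -/
theorem fderiv_bumpAt_eq_zero {g : ℤ × ℤ × ℤ} {u : ℝ × ℝ × ℝ}
    (hu : mulR (invR (castR g)) u ∉ Set.Icc (0 : ℝ) 2 ×ˢ (Set.Icc (0 : ℝ) 2 ×ˢ Set.Icc (0 : ℝ) 2)) :
    fderiv ℝ (bumpAt g) u = 0 := by
  apply fderiv_eq_zero_of_eventually_eq_zero
  -- the open set `{v : g⁻¹v ∉ [0,2]³}` contains `u`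
  have hopen : IsOpen {v : ℝ × ℝ × ℝ | mulR (invR (castR g)) v ∉
      Set.Icc (0 : ℝ) 2 ×ˢ (Set.Icc (0 : ℝ) 2 ×ˢ Set.Icc (0 : ℝ) 2)} := by
    have hc : Continuous (mulR (invR (castR g))) := (contDiff_mulR _).continuous
    exact (isClosed_Icc.prod (isClosed_Icc.prod isClosed_Icc)).isOpen_compl.preimage hc
  filter_upwards [hopen.mem_nhds hu] with v hv
  by_contra hne
  apply hv
  obtain ⟨⟨a1, a2⟩, ⟨b1, b2⟩, ⟨c1, c2⟩⟩ := bumpAt_ne_zero hne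
  rw [mulR_invR_castR_apply]
  simp only [Set.mem_prod, Set.mem_Icc]
  refine ⟨⟨by linarith, by linarith⟩, ⟨by linarith, by linarith⟩, ⟨by nlinarith, by nlinarith⟩⟩

end Calculus


/-! ### The window around a point -/

section Window

open Filter _root_.Topology

/-- **Relevant lattice points lie in a bounded ball around the cell point.** If `y⁻¹u₀` lies in the
stretched cell `[0,1)² × [0,2)` and `g⁻¹u₀ ∈ [0,2]³`, then `y⁻¹g ∈ 𝓑_{30}` (its coordinates are
bounded by `2, 2, 8`, and the box `|x|,|y| ≤ 3, |z| ≤ 9` lies in `𝓑_{30}` by `box_subset_wordBall`).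
[cite: NaorYoung2018, §3.2 Lemma 3.6] -/
theorem heisInv_mul_mem_wordBall_of_rel {y g : ℤ × ℤ × ℤ} {u₀ : ℝ × ℝ × ℝ}
    (hy1 : 0 ≤ u₀.1 - y.1 ∧ u₀.1 - y.1 < 1) (hy2 : 0 ≤ u₀.2.1 - y.2.1 ∧ u₀.2.1 - y.2.1 < 1)
    (hy3 : 0 ≤ u₀.2.2 - y.2.2 - y.1 * (u₀.2.1 - y.2.1) ∧ u₀.2.2 - y.2.2 - y.1 * (u₀.2.1 - y.2.1) < 2)
    (hg : mulR (invR (castR g)) u₀ ∈ Set.Icc (0 : ℝ) 2 ×ˢ (Set.Icc (0 : ℝ) 2 ×ˢ Set.Icc (0 : ℝ) 2)) :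
    heisMul (heisInv y) g ∈ wordBall 30 := by
  rw [mulR_invR_castR_apply] at hg
  simp only [Set.mem_prod, Set.mem_Icc] at hg
  obtain ⟨⟨g1a, g1b⟩, ⟨g2a, g2b⟩, ⟨g3a, g3b⟩⟩ := hg
  have e : heisMul (heisInv y) g = (g.1 - y.1, g.2.1 - y.2.1, g.2.2 - y.2.2 - y.1 * (g.2.1 - y.2.1)) := by
    simp only [heisMul, heisInv, Prod.mk.injEq]
    exact ⟨by ring, by ring, by ring⟩
  rw [e, show (30 : ℕ) = 10 * 3 by norm_num]
  -- real bounds on the integer coordinates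
  have hz1 : |((g.1 - y.1 : ℤ) : ℝ)| ≤ 3 := by
    push_cast; rw [abs_le]; constructor <;> linarith
  have hz2 : |((g.2.1 - y.2.1 : ℤ) : ℝ)| ≤ 3 := by
    push_cast; rw [abs_le]; constructor <;> linarith
  have hz3 : |((g.2.2 - y.2.2 - y.1 * (g.2.1 - y.2.1) : ℤ) : ℝ)| ≤ 9 := by
    push_cast
    -- `z₃ = s_y − s_g − z₁ (u₀₂ − b_g)` with `s_y ∈ [0,2)`, `s_g ∈ [0,2]`, `|z₁| ≤ 2`
    have key : (g.2.2 : ℝ) - y.2.2 - y.1 * (g.2.1 - y.2.1) =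
        (u₀.2.2 - y.2.2 - y.1 * (u₀.2.1 - y.2.1)) -
          (u₀.2.2 - g.2.2 + g.1 * g.2.1 - g.1 * u₀.2.1) - (g.1 - y.1) * (u₀.2.1 - g.2.1) := by ring
    rw [key, abs_le]
    have hp : |((g.1 : ℝ) - y.1) * (u₀.2.1 - g.2.1)| ≤ 4 := by
      rw [abs_mul]
      have h1 : |(g.1 : ℝ) - y.1| ≤ 2 := by rw [abs_le]; constructor <;> linarith
      have h2 : |u₀.2.1 - (g.2.1 : ℝ)| ≤ 2 := by rw [abs_le]; constructor <;> linarith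
      nlinarith [abs_nonneg ((g.1 : ℝ) - y.1), abs_nonneg (u₀.2.1 - (g.2.1 : ℝ))]
    have hp' := abs_le.mp hp
    constructor <;> linarith
  refine box_subset_wordBall (n := 3) ?_ ?_ ?_
  · have : |(g.1 - y.1 : ℤ)| ≤ 3 := by exact_mod_cast hz1
    simpa using this
  · have : |(g.2.1 - y.2.1 : ℤ)| ≤ 3 := by exact_mod_cast hz2
    simpa using this
  · have : |(g.2.2 - y.2.2 - y.1 * (g.2.1 - y.2.1) : ℤ)| ≤ 9 := by exact_mod_cast hz3
    simpa using this

/-- **The window partition identity near a point.** For `u₀ ∈ ℍ(ℝ)` and the integer window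
`a ∈ [⌊u₀₁⌋−2, ⌊u₀₁⌋+1]`, `b ∈ [⌊u₀₂⌋−2, ⌊u₀₂⌋+1]`, `c ∈ [⌊u₀₃⌋−K−3, ⌊u₀₃⌋+K+2]`,
`K = ⌈4(|u₀₁|+3)⌉`, the translates `χ_{(a,b,c)}` sum to `1` at every `u` with `‖u − u₀‖_∞ < 1`.
[cite: NaorYoung2018, §3.2 Lemma 3.6] -/
theorem sum_bumpAt_window_near (u₀ u : ℝ × ℝ × ℝ) (h1 : |u.1 - u₀.1| < 1) (h2 : |u.2.1 - u₀.2.1| < 1)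
    (h3 : |u.2.2 - u₀.2.2| < 1) :
    ∑ i ∈ Finset.range 4, ∑ j ∈ Finset.range 4, ∑ k ∈ Finset.range (2 * ⌈4 * (|u₀.1| + 3)⌉₊ + 6),
      bumpAt (⌊u₀.1⌋ - 2 + i, ⌊u₀.2.1⌋ - 2 + j, ⌊u₀.2.2⌋ - ⌈4 * (|u₀.1| + 3)⌉₊ - 3 + k) u = 1 := by
  set K : ℕ := ⌈4 * (|u₀.1| + 3)⌉₊ with hK
  have hKr : 4 * (|u₀.1| + 3) ≤ (K : ℝ) := Nat.le_ceil _
  have ha0 := Int.floor_le u₀.1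
  have ha1 := Int.lt_floor_add_one u₀.1
  have hb0 := Int.floor_le u₀.2.1
  have hb1 := Int.lt_floor_add_one u₀.2.1
  have hc0 := Int.floor_le u₀.2.2
  have hc1 := Int.lt_floor_add_one u₀.2.2
  rw [abs_lt] at h1 h2 h3
  refine sum_bumpAt_window u (⌊u₀.1⌋ - 2) (⌊u₀.2.1⌋ - 2) (⌊u₀.2.2⌋ - K - 3) 4 (2 * K + 6)
    (by push_cast; linarith) (by push_cast; linarith) (by push_cast; linarith) (by push_cast; linarith)
    fun i hi j hj => ?_
  rw [Finset.mem_range] at hi hj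
  have hi' : (i : ℝ) ≤ 3 := by exact_mod_cast (by omega : i ≤ 3)
  have hj' : (j : ℝ) ≤ 3 := by exact_mod_cast (by omega : j ≤ 3)
  have hi0 : (0 : ℝ) ≤ i := by positivity
  have hj0 : (0 : ℝ) ≤ j := by positivity
  -- `|X| ≤ K` for `X = (p₁+i)(u₂ − (p₂+j))`
  have hX : |((⌊u₀.1⌋ : ℝ) - 2 + i) * (u.2.1 - ((⌊u₀.2.1⌋ : ℝ) - 2 + j))| ≤ K := by
    rw [abs_mul]
    have hA : |((⌊u₀.1⌋ : ℝ) - 2 + i)| ≤ |u₀.1| + 3 := by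
      rw [abs_le]
      have hu := le_abs_self u₀.1
      have hu' := neg_abs_le u₀.1
      constructor <;> linarith
    have hB : |u.2.1 - ((⌊u₀.2.1⌋ : ℝ) - 2 + j)| ≤ 4 := by
      rw [abs_le]
      constructor <;> linarith
    calc |((⌊u₀.1⌋ : ℝ) - 2 + i)| * |u.2.1 - ((⌊u₀.2.1⌋ : ℝ) - 2 + j)|
        ≤ (|u₀.1| + 3) * 4 := mul_le_mul hA hB (abs_nonneg _) (by positivity)
      _ = 4 * (|u₀.1| + 3) := by ring
      _ ≤ K := hKr
  have hX' := abs_le.mp hX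
  constructor
  · push_cast
    linarith [hX'.1, hX'.2]
  · push_cast
    linarith [hX'.1, hX'.2]

/-- **The window sum has zero derivative**: `Σ_{window} Dχ_g(u₀) = 0` (the sum is identically `1`
near `u₀`). [cite: NaorYoung2018, §3.2 Lemma 3.6] -/
theorem sum_fderiv_bumpAt_window_eq_zero (u₀ : ℝ × ℝ × ℝ) :
    ∑ i ∈ Finset.range 4, ∑ j ∈ Finset.range 4, ∑ k ∈ Finset.range (2 * ⌈4 * (|u₀.1| + 3)⌉₊ + 6),
      fderiv ℝ (bumpAt (⌊u₀.1⌋ - 2 + i, ⌊u₀.2.1⌋ - 2 + j, ⌊u₀.2.2⌋ - ⌈4 * (|u₀.1| + 3)⌉₊ - 3 + k)) u₀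
        = 0 := by
  set K : ℕ := ⌈4 * (|u₀.1| + 3)⌉₊ with hK
  set S : (ℝ × ℝ × ℝ) → ℝ := fun u => ∑ i ∈ Finset.range 4, ∑ j ∈ Finset.range 4,
    ∑ k ∈ Finset.range (2 * K + 6),
      bumpAt (⌊u₀.1⌋ - 2 + i, ⌊u₀.2.1⌋ - 2 + j, ⌊u₀.2.2⌋ - K - 3 + k) u with hS
  -- `S` has derivative the window sum of derivatives
  have hderiv : HasFDerivAt S (∑ i ∈ Finset.range 4, ∑ j ∈ Finset.range 4,
      ∑ k ∈ Finset.range (2 * K + 6),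
        fderiv ℝ (bumpAt (⌊u₀.1⌋ - 2 + i, ⌊u₀.2.1⌋ - 2 + j, ⌊u₀.2.2⌋ - K - 3 + k)) u₀) u₀ := by
    refine HasFDerivAt.fun_sum fun i _ => HasFDerivAt.fun_sum fun j _ =>
      HasFDerivAt.fun_sum fun k _ => ?_
    exact ((contDiff_bumpAt _).differentiable (by simp) _).hasFDerivAt
  -- `S = 1` near `u₀`
  have hnear : ∀ᶠ u in 𝓝 u₀, S u = 1 := by
    have o1 : IsOpen {u : ℝ × ℝ × ℝ | |u.1 - u₀.1| < 1} :=
      isOpen_lt (continuous_fst.sub continuous_const).abs continuous_const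
    have o2 : IsOpen {u : ℝ × ℝ × ℝ | |u.2.1 - u₀.2.1| < 1} :=
      isOpen_lt ((continuous_fst.comp continuous_snd).sub continuous_const).abs continuous_const
    have o3 : IsOpen {u : ℝ × ℝ × ℝ | |u.2.2 - u₀.2.2| < 1} :=
      isOpen_lt ((continuous_snd.comp continuous_snd).sub continuous_const).abs continuous_const
    have hopen := o1.inter (o2.inter o3)
    have hmem : u₀ ∈ {u : ℝ × ℝ × ℝ | |u.1 - u₀.1| < 1} ∩ ({u : ℝ × ℝ × ℝ | |u.2.1 - u₀.2.1| < 1} ∩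
        {u : ℝ × ℝ × ℝ | |u.2.2 - u₀.2.2| < 1}) := by
      simp only [Set.mem_inter_iff, Set.mem_setOf_eq, sub_self, abs_zero]
      norm_num
    filter_upwards [hopen.mem_nhds hmem] with u hu
    exact sum_bumpAt_window_near u₀ u hu.1 hu.2.1 hu.2.2
  have hzero : HasFDerivAt S (0 : ℝ × ℝ × ℝ →L[ℝ] ℝ) u₀ :=
    (hasFDerivAt_const (1 : ℝ) u₀).congr_of_eventuallyEq hnear
  exact hderiv.unique hzero

/-- **Coverage by the window**: a translate `χ_g` which does not vanish somewhere in the sup-norm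
unit neighbourhood of `u₀` has `g` in the window. [cite: NaorYoung2018, §3.2 Lemma 3.6] -/
theorem exists_window_index_of_bumpAt_ne_zero {u₀ u : ℝ × ℝ × ℝ} {g : ℤ × ℤ × ℤ}
    (h1 : |u.1 - u₀.1| < 1) (h2 : |u.2.1 - u₀.2.1| < 1) (h3 : |u.2.2 - u₀.2.2| < 1)
    (hg : bumpAt g u ≠ 0) :
    ∃ i ∈ Finset.range 4, ∃ j ∈ Finset.range 4, ∃ k ∈ Finset.range (2 * ⌈4 * (|u₀.1| + 3)⌉₊ + 6),
      g = (⌊u₀.1⌋ - 2 + i, ⌊u₀.2.1⌋ - 2 + j, ⌊u₀.2.2⌋ - ⌈4 * (|u₀.1| + 3)⌉₊ - 3 + k) := by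
  set K : ℕ := ⌈4 * (|u₀.1| + 3)⌉₊ with hK
  have hKr : 4 * (|u₀.1| + 3) ≤ (K : ℝ) := Nat.le_ceil _
  have ha0 := Int.floor_le u₀.1
  have ha1 := Int.lt_floor_add_one u₀.1
  have hb0 := Int.floor_le u₀.2.1
  have hb1 := Int.lt_floor_add_one u₀.2.1
  have hc0 := Int.floor_le u₀.2.2
  have hc1 := Int.lt_floor_add_one u₀.2.2
  rw [abs_lt] at h1 h2 h3
  obtain ⟨⟨g1a, g1b⟩, ⟨g2a, g2b⟩, ⟨g3a, g3b⟩⟩ := bumpAt_ne_zero hg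
  -- integer bounds on `g.1`, `g.2.1`
  have i1 : ⌊u₀.1⌋ - 2 ≤ g.1 := by
    have : ((⌊u₀.1⌋ : ℤ) : ℝ) - 3 < g.1 := by linarith
    have : (⌊u₀.1⌋ : ℤ) - 3 < g.1 := by exact_mod_cast this
    omega
  have i2 : g.1 ≤ ⌊u₀.1⌋ + 1 := by
    have : (g.1 : ℝ) < (⌊u₀.1⌋ : ℤ) + 2 := by linarith
    have : g.1 < (⌊u₀.1⌋ : ℤ) + 2 := by exact_mod_cast this
    omega
  have j1 : ⌊u₀.2.1⌋ - 2 ≤ g.2.1 := by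
    have : ((⌊u₀.2.1⌋ : ℤ) : ℝ) - 3 < g.2.1 := by linarith
    have : (⌊u₀.2.1⌋ : ℤ) - 3 < g.2.1 := by exact_mod_cast this
    omega
  have j2 : g.2.1 ≤ ⌊u₀.2.1⌋ + 1 := by
    have : (g.2.1 : ℝ) < (⌊u₀.2.1⌋ : ℤ) + 2 := by linarith
    have : g.2.1 < (⌊u₀.2.1⌋ : ℤ) + 2 := by exact_mod_cast this
    omega
  -- `|Y| ≤ K` for `Y = g₁ (u₂ − g₂)`
  have hY : |(g.1 : ℝ) * (u.2.1 - g.2.1)| ≤ K := by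
    rw [abs_mul]
    have hA : |(g.1 : ℝ)| ≤ |u₀.1| + 3 := by
      rw [abs_le]
      have hu := le_abs_self u₀.1
      have hu' := neg_abs_le u₀.1
      constructor <;> linarith
    have hB : |u.2.1 - (g.2.1 : ℝ)| ≤ 2 := by
      rw [abs_le]; constructor <;> linarith
    calc |(g.1 : ℝ)| * |u.2.1 - (g.2.1 : ℝ)| ≤ (|u₀.1| + 3) * 2 :=
          mul_le_mul hA hB (abs_nonneg _) (by positivity)
      _ ≤ 4 * (|u₀.1| + 3) := by nlinarith [abs_nonneg u₀.1]
      _ ≤ K := hKr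
  have hY' := abs_le.mp hY
  have k1 : ⌊u₀.2.2⌋ - K - 3 ≤ g.2.2 := by
    have : ((⌊u₀.2.2⌋ : ℤ) : ℝ) - K - 3 < g.2.2 := by linarith
    have : (⌊u₀.2.2⌋ : ℤ) - K - 3 < g.2.2 := by exact_mod_cast this
    omega
  have k2 : g.2.2 ≤ ⌊u₀.2.2⌋ + K + 2 := by
    have : (g.2.2 : ℝ) < (⌊u₀.2.2⌋ : ℤ) + K + 2 := by linarith
    have : g.2.2 < (⌊u₀.2.2⌋ : ℤ) + K + 2 := by exact_mod_cast this
    omega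
  refine ⟨(g.1 - (⌊u₀.1⌋ - 2)).toNat, ?_, (g.2.1 - (⌊u₀.2.1⌋ - 2)).toNat, ?_,
    (g.2.2 - (⌊u₀.2.2⌋ - K - 3)).toNat, ?_, ?_⟩
  · rw [Finset.mem_range]; omega
  · rw [Finset.mem_range]; omega
  · rw [Finset.mem_range]; omega
  · obtain ⟨a, b, c⟩ := g
    simp only [Prod.mk.injEq]
    simp only at i1 i2 j1 j2 k1 k2
    refine ⟨by omega, by omega, by omega⟩

end Window

end Literature.Geometry.MetricEmbeddings

end
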